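import Summits.ResolutionOfSingularities.ResolutionOfSingularities.Theorems.RadicialJungCleanModelsCcurveRegStep
import Summits.ResolutionOfSingularities.ResolutionOfSingularities.Theorems.RadicialJungCleanModelsCcurveRegHIO
import Summits.ResolutionOfSingularities.ResolutionOfSingularities.Theorems.RadicialJungCleanModelsCleanLU3ArcPackage
import Literature.AlgebraicGeometry.Resolution.RegularLocalHeights
import Literature.AlgebraicGeometry.Resolution.IntegralClosureEssFiniteType
import Literature.AlgebraicGeometry.Resolution.EmbeddedResolutionExcellentSurfaces
import HarnessLib

/-!
# Route `RadicialJung`, crux `CleanModels` (stmt-15917) — (C-curve) sub-line: the geometric core `curveRegularize` (S3-core), CLASSICAL and F-32-FREE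

Lead `res-B-lead-1` g7 (workfile `Lines/Sketch_Ccurve_assembly.lean` v2.9, the last `sorry` `stub_Cc_curveRegularize`).  OURS · counted 0.  Nothing here proves
resolution in characteristic `p`; resolution in char `p` is NOT proved.

`curveRegularize`: for a model `B` regular of dimension 3 at the centre of `O` and a coarsening `O₁` whose local ring `R₁ = locAtCentre B O₁` has dimension 2 (the
centre of `O₁` is a curve `C` through the centre `P` of `O`), finitely many quadratic transforms ALONG `O` — point blow-ups, with finitely generated models
(✓ `exists_quadraticSeq_package`), all inside `R₁` (✓ `quadraticSeq_le_coarse`) — lead to a model `B′` regular of dimension 3 at the centre of `O` whose centre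
curve of `O₁` is REGULAR of dimension 1 at `P′`: the residues of the transforms in `L = κ(R₁)` form the quadratic sequence of the one-dimensional local domain
`S/𝔮 ⊆ L` along the residue valuation ring `V̄` of `O` (✓ `img_quadraticSeq`), whose normalisation is finite (E. Noether, ✓ `module_finite_integralClosure_of_essFiniteType`),
so it reaches `V̄` (Herrmann–Ikeda–Orbanz, ✓ `exists_sequence_eq_valuationSubring` with the data of ✓ `hio_data_of_valuationSubring`); at that stage
`S_c/𝔮_c ≅ V̄` is a Noetherian valuation ring, not a field, i.e. a discrete valuation ring: regular of dimension 1.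
`stub_Cc_curveRegularize_of` is the registered form (with the — now unused — F-32 binder).  NO printed input is used.
-/

noncomputable section

set_option linter.dupNamespace false

open IsLocalRing Literature.AlgebraicGeometry.Resolution
open Summit.ResolutionOfSingularities.ResolutionOfSingularities.Theorems
open Summit.ResolutionOfSingularities.ResolutionOfSingularities.Theorems.SwitchingDichotomy

namespace Summit.ResolutionOfSingularities.ResolutionOfSingularities.Theorems.RadicialJung.CleanModels.Ccurve

/-- Transport of «the image of `T ⊆ R₁` is `W`» along an equality of subrings. [folklore] -/
theorem img_eq_of_eq {K : Type} [Field K] {R₁ : Subring K} [IsLocalRing ↥R₁] {T T' : Subring K} (h : T = T') (hT : T ≤ R₁) (hT' : T' ≤ R₁)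
    {W : Subring (ResidueField ↥R₁)} (hW : ((residue ↥R₁).comp (Subring.inclusion hT)).range = W) :
    ((residue ↥R₁).comp (Subring.inclusion hT')).range = W := by
  subst h; exact hW

/-- A valuation subring of a field which is Noetherian and has a nonzero non-unit is a discrete valuation ring, hence regular of dimension `1`. [folklore] -/
theorem regular_of_valuationSubring_noetherian {L : Type} [Field L] (V : ValuationSubring L) [IsNoetherianRing ↥V]
    {ξ : L} (hξV : ξ ∈ V) (hξ0 : ξ ≠ 0) (hξlt : V.valuation ξ < 1) :
    IsRegularLocalRing ↥V ∧ ringKrullDim ↥V = 1 := by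
  have hnf : ¬ IsField ↥V := by
    intro hF
    have hu : IsUnit (⟨ξ, hξV⟩ : ↥V) := by
      letI := hF.toField
      exact isUnit_iff_ne_zero.mpr (fun h => hξ0 (congrArg Subtype.val h))
    have h1 : V.valuation ξ = 1 := (V.valuation_eq_one_iff ⟨ξ, hξV⟩).mp hu
    rw [h1] at hξlt; exact lt_irrefl _ hξlt
  haveI : IsDiscreteValuationRing ↥V := ((IsDiscreteValuationRing.TFAE ↥V hnf).out 0 1).mpr (inferInstance : ValuationRing ↥V)
  exact ⟨inferInstance, IsPrincipalIdealRing.ringKrullDim_eq_one _ hnf⟩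

/-- **The geometric core `curveRegularize`, classical and F-32-free** — see the module docstring. [folklore] -/
theorem curveRegularize :
    ∀ (k : Type) [Field k] (K : Type) [Field K] [Algebra k K]
    (O : ValuationSubring K) (A : Subalgebra k K), A.toSubring ≤ O.toSubring → A.FG → IsFractionRing A K → ringKrullDim A ≤ 3 →
    (∀ (T : Subring K) (hT : T ≤ O.toSubring), A.toSubring ≤ T → (subringCentre T O hT).IsMaximal) →
    ∀ (B : Subalgebra k K) (hBO : B.toSubring ≤ O.toSubring), A ≤ B → B.FG →
    IsRegularLocalRing (locAtCentre B.toSubring O) → ringKrullDim (locAtCentre B.toSubring O) = 3 →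
    ∀ (O₁ : ValuationSubring K) (hOO₁ : O ≤ O₁), ringKrullDim (locAtCentre B.toSubring O₁) = 2 →
    ∃ (B' : Subalgebra k K) (hB'O : B'.toSubring ≤ O.toSubring), B ≤ B' ∧ B'.FG ∧
    IsRegularLocalRing (locAtCentre B'.toSubring O) ∧ ringKrullDim (locAtCentre B'.toSubring O) = 3 ∧
    B'.toSubring ≤ locAtCentre B.toSubring O₁ ∧
    IsRegularLocalRing (↥(locAtCentre B'.toSubring O) ⧸
      subringCentre (locAtCentre B'.toSubring O) O₁ (fun _ hw => hOO₁ (locAtCentre_le hB'O hw))) ∧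
    ringKrullDim (↥(locAtCentre B'.toSubring O) ⧸
      subringCentre (locAtCentre B'.toSubring O) O₁ (fun _ hw => hOO₁ (locAtCentre_le hB'O hw))) = 1 := by
  intro k _ K _ _ O A hAO hAfg hfrac hdimA hzd B hBO hAB hBfg hBreg hBdim O₁ hOO₁ hBdim₁
  classical
  haveI := hfrac
  haveI : IsFractionRing ↥B K := by
    refine IsFractionRing.of_field _ K fun z => ?_
    obtain ⟨a, b, hb, hab⟩ := IsFractionRing.div_surjective (A := ↥A) z
    exact ⟨⟨a, hAB a.2⟩, ⟨b, hAB b.2⟩, hab.symm⟩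
  -- the two local rings
  have hBO₁ : B.toSubring ≤ O₁.toSubring := fun w hw => hOO₁ (hBO hw)
  haveI := isLocalRing_locAtCentre hBO
  haveI : IsRegularLocalRing ↥(locAtCentre B.toSubring O) := hBreg
  haveI := isLocalRing_locAtCentre hBO₁
  have hR₁O₁ : locAtCentre B.toSubring O₁ ≤ O₁.toSubring := locAtCentre_le hBO₁
  have hinv : ∀ {r : K}, r ∈ locAtCentre B.toSubring O₁ → O₁.valuation r = 1 → r⁻¹ ∈ locAtCentre B.toSubring O₁ :=
    fun hr hv => inv_mem_locAtCentre hr hv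
  have hSR₁ : locAtCentre B.toSubring O ≤ locAtCentre B.toSubring O₁ := le_locAtCentre_coarse hOO₁
  -- the witness: an `O`-non-unit of `B` which is an `O₁`-unit
  obtain ⟨x, hxB, hvx, hvx₁⟩ := exists_fine_nonunit_coarse_unit hBO hOO₁ (by rw [hBdim, hBdim₁]; decide)
  -- the quadratic sequence along `O`
  have hzdB : ∀ (T : Subring K) (hT : T ≤ O.toSubring), B.toSubring ≤ T → (subringCentre T O hT).IsMaximal :=
    fun T hT hBT => hzd T hT fun w hw => hBT (hAB hw)
  obtain ⟨R, hR0, hstep, hregR, hdimR, hmodel⟩ :=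
    exists_quadraticSeq_package B O hBO hBfg hBreg (by rw [hBdim]; decide) hzdB
  have hB0 : B.toSubring ≤ R 0 := by rw [hR0]; exact le_locAtCentre _ _
  have hRle : ∀ i, R i ≤ locAtCentre B.toSubring O₁ :=
    quadraticSeq_le_coarse hOO₁ R hB0 (by rw [hR0]; exact hSR₁) hstep hxB hvx hvx₁
  have hRO : ∀ i, R i ≤ O.toSubring := fun i => by
    obtain ⟨A', hA'O, -, -, hRi⟩ := hmodel i; rw [hRi]; exact locAtCentre_le hA'O
  -- the residue valuation ring and the residue sequence
  obtain ⟨V, hV₁, hV₂⟩ := exists_residueValuationSubring (O := O) hR₁O₁ hinv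
  have hstepD := img_quadraticSeq hOO₁ hR₁O₁ hinv V hV₁ hV₂ R hRle hstep (hB0 hxB) hvx hvx₁
  -- the first member `D₀ = img (R 0)`, `R 0 = S`
  haveI hreg0 : IsRegularLocalRing ↥(R 0) := hregR 0
  have hR0O₁ : R 0 ≤ O₁.toSubring := fun w hw => hOO₁ (hRO 0 hw)
  have hfrac' : ∀ r ∈ locAtCentre B.toSubring O₁, ∃ a ∈ R 0, ∃ b ∈ R 0, O₁.valuation b = 1 ∧ r = a / b := by
    intro r hr
    obtain ⟨a, ha, b, hb, hvb, rfl⟩ := mem_locAtCentre_iff.mp hr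
    exact ⟨a, hB0 ha, b, hB0 hb, hvb, rfl⟩
  have hof0 : IsLocalRingOf ((residue ↥(locAtCentre B.toSubring O₁)).comp (Subring.inclusion (hRle 0))).range :=
    isLocalRingOf_img hR₁O₁ hinv (hRle 0) hfrac'
  have h0dom : SubringDominates ((residue ↥(locAtCentre B.toSubring O₁)).comp (Subring.inclusion (hRle 0))).range V.toSubring :=
    img_dominated hOO₁ hR₁O₁ hinv V hV₁ hV₂ (hRle 0) (hRO 0) fun t ht hvt => by
      rw [hR0] at ht ⊢; exact inv_mem_locAtCentre ht hvt
  -- the kernel of the residue map on `R i` is the centre of `O₁`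
  have hker : ∀ (T : Subring K) (hT : T ≤ locAtCentre B.toSubring O₁) (hTO₁ : T ≤ O₁.toSubring),
      RingHom.ker ((residue ↥(locAtCentre B.toSubring O₁)).comp (Subring.inclusion hT)) = subringCentre T O₁ hTO₁ := by
    intro T hT hTO₁
    ext t
    rw [RingHom.mem_ker, mem_subringCentre_iff]
    exact residue_eq_zero_iff_coarse hR₁O₁ hinv ⟨(t : K), hT t.2⟩
  -- dimension of `D₀`: `dim S/𝔮 = dim S - ht 𝔮 = 3 - 2`
  have hdimD0 : ringKrullDim ↥((residue ↥(locAtCentre B.toSubring O₁)).comp (Subring.inclusion (hRle 0))).range = 1 := by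
    set φ := (residue ↥(locAtCentre B.toSubring O₁)).comp (Subring.inclusion (hRle 0)) with hφ
    set 𝔮 := subringCentre (R 0) O₁ hR0O₁ with h𝔮
    have e : (↥(R 0) ⧸ 𝔮) ≃+* ↥φ.range := (Ideal.quotEquivOfEq (hker (R 0) (hRle 0) hR0O₁).symm).trans (RingHom.quotientKerEquivRange φ)
    rw [← ringKrullDim_eq_of_ringEquiv e]
    haveI := isLocalization_locAtCentre (K := K) (O := O₁) hR0O₁
    have hloc : locAtCentre (R 0) O₁ = locAtCentre B.toSubring O₁ := by
      rw [hR0]; exact Shannon.locAtCentre_locAtCentre_of_le hOO₁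
    have hht : (𝔮.height : WithBot ℕ∞) = 2 := by
      rw [← IsLocalization.AtPrime.ringKrullDim_eq_height 𝔮 ↥(locAtCentre (R 0) O₁), hloc, hBdim₁]
    have hform := height_add_ringKrullDim_quotient (S := ↥(R 0)) 𝔮
    rw [hht, hdimR 0, hBdim] at hform
    -- `2 + d = 3` in `WithBot ℕ∞`
    haveI : Nontrivial (↥(R 0) ⧸ 𝔮) := Ideal.Quotient.nontrivial_iff.mpr (Ideal.IsPrime.ne_top inferInstance)
    haveI : IsLocalRing (↥(R 0) ⧸ 𝔮) := IsLocalRing.of_surjective' _ Ideal.Quotient.mk_surjective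
    have hnb : ringKrullDim (↥(R 0) ⧸ 𝔮) ≠ ⊥ := ringKrullDim_ne_bot
    have hnt : ringKrullDim (↥(R 0) ⧸ 𝔮) ≠ ⊤ := ringKrullDim_ne_top
    revert hform hnb hnt
    generalize ringKrullDim (↥(R 0) ⧸ 𝔮) = d
    intro hform hnb hnt
    induction d using WithBot.recBotCoe with
    | bot => exact absurd rfl hnb
    | coe d =>
      induction d using ENat.recTopCoe with
      | top => exact absurd rfl hnt
      | coe n =>
        have h3 : ((2 : WithBot ℕ∞) + ((n : ℕ∞) : WithBot ℕ∞)) = ((((2 + n : ℕ) : ℕ∞)) : WithBot ℕ∞) := by push_cast; rfl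
        have h3' : (3 : WithBot ℕ∞) = (((3 : ℕ) : ℕ∞) : WithBot ℕ∞) := by norm_cast
        rw [h3, h3'] at hform
        have hn : ((2 + n : ℕ) : ℕ∞) = ((3 : ℕ) : ℕ∞) := WithBot.coe_inj.mp hform
        have hn' : 2 + n = 3 := by exact_mod_cast hn
        have : n = 1 := by omega
        subst this; rfl
  haveI : IsNoetherianRing ↥((residue ↥(locAtCentre B.toSubring O₁)).comp (Subring.inclusion (hRle 0))).range := inferInstance
  haveI : Ring.KrullDimLE 1 ↥((residue ↥(locAtCentre B.toSubring O₁)).comp (Subring.inclusion (hRle 0))).range := by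
    rw [Ring.krullDimLE_iff, hdimD0]; exact le_rfl
  have hnf0 : ¬ IsField ↥((residue ↥(locAtCentre B.toSubring O₁)).comp (Subring.inclusion (hRle 0))).range := fun hF => by
    have := ringKrullDim_eq_zero_of_isField hF
    rw [hdimD0] at this; exact one_ne_zero this
  -- E. Noether: the normalisation of `D₀` is finite (`D₀` is essentially of finite type over `k`)
  letI : Algebra k ↥B.toSubring := inferInstanceAs (Algebra k ↥B)
  haveI : Algebra.FiniteType k ↥B.toSubring := (B.fg_iff_finiteType.mp hBfg : Algebra.FiniteType k ↥B)
  haveI := isLocalization_locAtCentre (K := K) (O := O) hBO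
  haveI hEssS : Algebra.EssFiniteType ↥B.toSubring ↥(locAtCentre B.toSubring O) :=
    Algebra.EssFiniteType.of_isLocalization _ (subringCentre B.toSubring O hBO).primeCompl
  letI algkS : Algebra k ↥(locAtCentre B.toSubring O) :=
    ((algebraMap ↥B.toSubring ↥(locAtCentre B.toSubring O)).comp (algebraMap k ↥B.toSubring)).toAlgebra
  haveI : IsScalarTower k ↥B.toSubring ↥(locAtCentre B.toSubring O) := IsScalarTower.of_algebraMap_eq fun _ => rfl
  haveI hEssS' : Algebra.EssFiniteType k ↥(locAtCentre B.toSubring O) := Algebra.EssFiniteType.comp k ↥B.toSubring _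
  set ψ₀ : ↥(locAtCentre B.toSubring O) →+* ↥((residue ↥(locAtCentre B.toSubring O₁)).comp (Subring.inclusion (hRle 0))).range :=
    ((residue ↥(locAtCentre B.toSubring O₁)).comp (Subring.inclusion (hRle 0))).rangeRestrict.comp (Subring.inclusion hR0.symm.le) with hψ₀
  have hψ₀surj : Function.Surjective ψ₀ := by
    intro y
    obtain ⟨r, hr⟩ := RingHom.rangeRestrict_surjective ((residue ↥(locAtCentre B.toSubring O₁)).comp (Subring.inclusion (hRle 0))) y
    refine ⟨⟨(r : K), by rw [← hR0]; exact r.2⟩, ?_⟩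
    rw [← hr]; rfl
  letI algkD : Algebra k ↥((residue ↥(locAtCentre B.toSubring O₁)).comp (Subring.inclusion (hRle 0))).range :=
    (ψ₀.comp (algebraMap k ↥(locAtCentre B.toSubring O))).toAlgebra
  let ψ₀ₐ : ↥(locAtCentre B.toSubring O) →ₐ[k] ↥((residue ↥(locAtCentre B.toSubring O₁)).comp (Subring.inclusion (hRle 0))).range :=
    { ψ₀ with commutes' := fun _ => rfl }
  haveI : Algebra.EssFiniteType k ↥((residue ↥(locAtCentre B.toSubring O₁)).comp (Subring.inclusion (hRle 0))).range :=
    Algebra.EssFiniteType.of_surjective ψ₀ₐ hψ₀surj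
  haveI : IsFractionRing ↥((residue ↥(locAtCentre B.toSubring O₁)).comp (Subring.inclusion (hRle 0))).range
      (ResidueField ↥(locAtCentre B.toSubring O₁)) := isFractionRing_of_isLocalRingOf_le hof0.2 le_rfl
  have hfin := module_finite_integralClosure_of_essFiniteType k ↥((residue ↥(locAtCentre B.toSubring O₁)).comp (Subring.inclusion (hRle 0))).range
    (ResidueField ↥(locAtCentre B.toSubring O₁))
  -- Herrmann–Ikeda–Orbanz: the residue sequence reaches `V̄`
  obtain ⟨N, Sset, hNV, hSN, hNS, hON⟩ := hio_data_of_valuationSubring hof0 hnf0 hfin V h0dom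
  obtain ⟨c, hc⟩ := exists_sequence_eq_valuationSubring
    (A := fun i => ((residue ↥(locAtCentre B.toSubring O₁)).comp (Subring.inclusion (hRle i))).range) (O := V)
    hof0 h0dom hstepD hNV Sset hSN hNS hON
  -- the model at stage `c`
  obtain ⟨A', hA'O, hBA', hA'fg, hRc⟩ := hmodel c
  have hT : locAtCentre A'.toSubring O ≤ locAtCentre B.toSubring O₁ := by rw [← hRc]; exact hRle c
  have hTO₁ : locAtCentre A'.toSubring O ≤ O₁.toSubring := fun w hw => hOO₁ (locAtCentre_le hA'O hw)
  have himg : ((residue ↥(locAtCentre B.toSubring O₁)).comp (Subring.inclusion hT)).range = V.toSubring := img_eq_of_eq hRc (hRle c) hT hc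
  haveI : IsRegularLocalRing ↥(locAtCentre A'.toSubring O) := by rw [← hRc]; exact hregR c
  -- `V̄` is Noetherian with a nonzero non-unit, hence a DVR: regular of dimension 1
  haveI : IsNoetherianRing ↥V.toSubring := by rw [← himg]; infer_instance
  let eV : ↥V.toSubring ≃+* ↥V :=
    { toFun := fun y => ⟨y.1, y.2⟩, invFun := fun y => ⟨y.1, y.2⟩, left_inv := fun _ => rfl, right_inv := fun _ => rfl,
      map_mul' := fun _ _ => rfl, map_add' := fun _ _ => rfl }
  haveI : IsNoetherianRing ↥V := isNoetherianRing_of_ringEquiv _ eV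
  have hxR₁ : x ∈ locAtCentre B.toSubring O₁ := hSR₁ (le_locAtCentre _ _ hxB)
  have hξ0 : residue ↥(locAtCentre B.toSubring O₁) ⟨x, hxR₁⟩ ≠ 0 := (residue_ne_zero_iff_coarse hR₁O₁ hinv ⟨x, hxR₁⟩).mpr hvx₁
  have hξV : residue ↥(locAtCentre B.toSubring O₁) ⟨x, hxR₁⟩ ∈ V := hV₁ _ (hBO hxB)
  have hξlt : V.valuation (residue ↥(locAtCentre B.toSubring O₁) ⟨x, hxR₁⟩) < 1 :=
    (residueVal_lt_one_iff hOO₁ hR₁O₁ hinv V hV₁ hV₂ ⟨x, hxR₁⟩ hvx₁).mpr hvx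
  obtain ⟨hVreg, hVdim⟩ := regular_of_valuationSubring_noetherian V hξV hξ0 hξlt
  -- the quotient `S′ ⧸ 𝔮′ ≅ V̄`
  set φ := (residue ↥(locAtCentre B.toSubring O₁)).comp (Subring.inclusion hT) with hφ
  have e : (↥(locAtCentre A'.toSubring O) ⧸ subringCentre (locAtCentre A'.toSubring O) O₁ hTO₁) ≃+* ↥V :=
    ((Ideal.quotEquivOfEq (hker _ hT hTO₁).symm).trans (RingHom.quotientKerEquivRange φ)).trans ((RingEquiv.subringCongr himg).trans eV)
  refine ⟨A', hA'O, hBA', hA'fg, inferInstance, by rw [← hRc, hdimR c, hBdim], (le_locAtCentre _ _).trans hT, ?_, ?_⟩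
  · haveI := hVreg; exact IsRegularLocalRing.of_ringEquiv e.symm
  · rw [ringKrullDim_eq_of_ringEquiv e, hVdim]

/-- **The registered stub `stub_Cc_curveRegularize` of the (C-curve) workfile** (its F-32 binder is not used: the classical proof is unconditional). [folklore] -/
theorem stub_Cc_curveRegularize_of : CossartJannsenSaito2020Embedded.{0} →
    ∀ (k : Type) [Field k] (K : Type) [Field K] [Algebra k K]
    (O : ValuationSubring K) (A : Subalgebra k K), A.toSubring ≤ O.toSubring → A.FG → IsFractionRing A K → ringKrullDim A ≤ 3 →
    (∀ (T : Subring K) (hT : T ≤ O.toSubring), A.toSubring ≤ T → (subringCentre T O hT).IsMaximal) →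
    ∀ (B : Subalgebra k K) (hBO : B.toSubring ≤ O.toSubring), A ≤ B → B.FG →
    IsRegularLocalRing (locAtCentre B.toSubring O) → ringKrullDim (locAtCentre B.toSubring O) = 3 →
    ∀ (O₁ : ValuationSubring K) (hOO₁ : O ≤ O₁), ringKrullDim (locAtCentre B.toSubring O₁) = 2 →
    ∃ (B' : Subalgebra k K) (hB'O : B'.toSubring ≤ O.toSubring), B ≤ B' ∧ B'.FG ∧
    IsRegularLocalRing (locAtCentre B'.toSubring O) ∧ ringKrullDim (locAtCentre B'.toSubring O) = 3 ∧
    B'.toSubring ≤ locAtCentre B.toSubring O₁ ∧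
    IsRegularLocalRing (↥(locAtCentre B'.toSubring O) ⧸
      subringCentre (locAtCentre B'.toSubring O) O₁ (fun _ hw => hOO₁ (locAtCentre_le hB'O hw))) ∧
    ringKrullDim (↥(locAtCentre B'.toSubring O) ⧸
      subringCentre (locAtCentre B'.toSubring O) O₁ (fun _ hw => hOO₁ (locAtCentre_le hB'O hw))) = 1 :=
  fun _ => curveRegularize

end Summit.ResolutionOfSingularities.ResolutionOfSingularities.Theorems.RadicialJung.CleanModels.Ccurve

end
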